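import Summits.RiemannHypothesis.RiemannHypothesis.Theorems.HandoffDodgerAsymptoticsD
import HarnessLib

/-!
# HANDOFF — ASYMPTOTICS (G): the window conditions (rh-explicit, track «HANDOFF», seat prove-2 gen10, ATTEMPT-19 §8 (P2))

HONEST FRAMING. Nothing here bears on the truth of RH; elementary real inequalities (Mathlib + part (D)'s `horizon_master`).
In the abstract variables of parts (D)–(F), with `L = log q`, `r = 1/(q³+1)` (the mollifier radius), `b + r ≤ L/2 ≤ b + 2r`,
`y = (3/5)L^{3/2}`, `δU = y/√pL`, `δL = y/√pU`, we prove the window conditions of `dodger_witness_explicit`: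
`2b ≤ L ≤ 2b+1`, `0 ≤ δU ≤ 1 ≤ b`, `6r ≤ δL`, `δU ≤ (7/100)(log q)^{3/2}q^{−3/2}`, `(log q)/2 + δU ≤ (log q′)/2` for `q′ ≥ q+1`,
and `0 < √q ≤ 1.011·e^b`. No `sorry`, standard axioms.

References: this track (ATTEMPT-16 §6; ATTEMPT-19 §8 (P2)).
-/

set_option linter.dupNamespace false

noncomputable section

open Real

namespace Summit.RiemannHypothesis.RiemannHypothesis.Theorems.Handoff

/-- The mollifier radius `r = 1/(q³+1)`: `0 < r ≤ 1/1000`, `rq³ ≤ 1`, `L ≥ 200`, `q = e^L ≥ 201`. [this track, ATTEMPT-19 §8 (P2)] -/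
theorem radius_facts {q : ℕ} {L b r : ℝ} (hq : 2 ≤ q) (hL : L = Real.log q) (hr : r = 1 / ((q : ℝ) ^ 3 + 1))
    (hbq1 : b + r ≤ L / 2) (hb : 100 ≤ b) :
    0 < r ∧ r ≤ 1 / 1000 ∧ r * (q : ℝ) ^ 3 ≤ 1 ∧ 200 ≤ L ∧ (q : ℝ) = Real.exp L ∧ (201 : ℝ) ≤ q := by
  have hq0 : (0 : ℝ) < q := by exact_mod_cast (by omega : 0 < q)
  have hqL : (q : ℝ) = Real.exp L := by rw [hL, Real.exp_log hq0]
  have hr0 : 0 < r := by rw [hr]; positivity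
  have hL200 : 200 ≤ L := by linarith
  have hq200 : (201 : ℝ) ≤ q := by
    rw [hqL]; have := Real.add_one_le_exp L; linarith
  have hq3 : (201 : ℝ) ^ 3 ≤ (q : ℝ) ^ 3 := pow_le_pow_left₀ (by norm_num) hq200 3
  have hr1 : r ≤ 1 / 1000 := by
    rw [hr]; apply div_le_div_of_nonneg_left (by norm_num) (by norm_num); nlinarith
  have hrq : r * (q : ℝ) ^ 3 ≤ 1 := by
    rw [hr, div_mul_eq_mul_div, one_mul, div_le_one (by positivity)]; linarith
  exact ⟨hr0, hr1, hrq, hL200, hqL, hq200⟩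

/-- `0.996·q ≤ e^{2b} ≤ q` and `16.83·q ≤ T ≤ 17.1·q`. [this track, ATTEMPT-19 §8 (P2)] -/
theorem horizon_vs_q {q : ℕ} {L b r T : ℝ} (hqL : (q : ℝ) = Real.exp L) (hq0 : (0 : ℝ) < q) (hr0 : 0 < r)
    (hr1 : r ≤ 1 / 1000) (hbq1 : b + r ≤ L / 2) (hbq2 : L / 2 ≤ b + 2 * r)
    (hTT₀ : T ≤ 2 * π * Real.exp (1 + 2 * b)) (hT₀T : 2 * π * Real.exp (1 + 2 * b) ≤ 101 / 100 * T) :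
    Real.exp (2 * b) ≤ q ∧ 0.996 * q ≤ Real.exp (2 * b) ∧ T ≤ 17.1 * q ∧ 16.83 * q ≤ T := by
  have hπ4 : π < 3.1416 := Real.pi_lt_d4
  set Eb2 := Real.exp (2 * b) with hEb2
  have hE1 : Eb2 ≤ q := by rw [hqL]; exact Real.exp_le_exp.2 (by linarith)
  have hE2 : 0.996 * q ≤ Eb2 := by
    have h1 : Real.exp (L - 4 * r) ≤ Eb2 := Real.exp_le_exp.2 (by linarith)
    rw [Real.exp_sub, hqL.symm] at h1
    have h2 : (q : ℝ) * (1 - 4 * r) ≤ (q : ℝ) / Real.exp (4 * r) := by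
      rw [div_eq_mul_inv, ← Real.exp_neg]
      apply mul_le_mul_of_nonneg_left _ hq0.le
      have := Real.add_one_le_exp (-(4 * r)); linarith
    nlinarith [mul_le_mul_of_nonneg_left hr1 hq0.le]
  have e1 : Real.exp (1 + 2 * b) = Real.exp 1 * Eb2 := by rw [Real.exp_add]
  rw [e1] at hTT₀ hT₀T
  have hTq1 : T ≤ 17.1 * q := by
    have h2πe : 2 * π * Real.exp 1 ≤ 17.1 := by
      have he := Real.exp_one_lt_d9
      nlinarith only [hπ4, he, Real.exp_pos 1, Real.pi_pos]
    have := mul_le_mul h2πe hE1 (Real.exp_pos _).le (by norm_num)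
    nlinarith only [this, hTT₀]
  have hTq2 : 16.83 * q ≤ T := by
    have h2πe : 17.079 ≤ 2 * π * Real.exp 1 := by
      have hp := Real.pi_gt_d6
      have he := Real.exp_one_gt_d9
      nlinarith only [hp, he]
    have := mul_le_mul h2πe hE2 (by positivity) (by positivity)
    nlinarith only [this, hT₀T]
  exact ⟨hE1, hE2, hTq1, hTq2⟩

/-- `δU = y/√pL ≤ 1`. [this track, ATTEMPT-19 §8 (P2)] -/
theorem deltaU_le_one {L b T pL y : ℝ} (hb : 100 ≤ b) (hL0 : 0 < L) (hL2 : L ≤ 2 * b + 1)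
    (hT : 110000 * (b + 1) ^ 2 ≤ T) (hpL : T ^ 3 / 31.42 ≤ pL) (hy0 : 0 ≤ y) (hy2 : y ^ 2 = 9 / 25 * L ^ 3) :
    y / Real.sqrt pL ≤ 1 := by
  have hT0 : 0 < T := by nlinarith
  have hpL0 : 0 < pL := lt_of_lt_of_le (by positivity) hpL
  rw [div_le_one (Real.sqrt_pos.2 hpL0), Real.le_sqrt hy0 hpL0.le, hy2]
  have h1 : 2.3 * (2 * b + 1) ≤ T := by nlinarith
  have h2 : (2.3 * (2 * b + 1)) ^ 3 ≤ T ^ 3 := pow_le_pow_left₀ (by positivity) h1 3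
  have h3 : L ^ 3 ≤ (2 * b + 1) ^ 3 := pow_le_pow_left₀ hL0.le hL2 3
  have h4 : T ^ 3 ≤ 31.42 * pL := by rw [div_le_iff₀ (by norm_num)] at hpL; linarith
  nlinarith

/-- `6r ≤ δL = y/√pU`. [this track, ATTEMPT-19 §8 (P2)] -/
theorem radius_le_deltaL {q : ℕ} {L b r T pU y : ℝ} (hr0 : 0 < r) (hr1 : r ≤ 1 / 1000) (hrq : r * (q : ℝ) ^ 3 ≤ 1)
    (hq0 : (0 : ℝ) < q) (hL200 : 200 ≤ L) (hL1 : 2 * b ≤ L) (hT0 : 0 < T) (hTq1 : T ≤ 17.1 * q) (hpU0 : 0 < pU)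
    (hpU : pU ≤ 41 / 100 * b * T ^ 3) (hy0 : 0 ≤ y) (hy2 : y ^ 2 = 9 / 25 * L ^ 3) :
    6 * r ≤ y / Real.sqrt pU := by
  have e : y / Real.sqrt pU = Real.sqrt (y ^ 2 / pU) := by rw [Real.sqrt_div (sq_nonneg y), Real.sqrt_sq hy0]
  rw [e, Real.le_sqrt (by linarith) (by positivity), le_div_iff₀ hpU0, hy2]
  have h1 : T ^ 3 ≤ (17.1 * q) ^ 3 := pow_le_pow_left₀ hT0.le hTq1 3
  have h2 : (6 * r) ^ 2 * pU ≤ (6 * r) ^ 2 * (41 / 100 * (L / 2) * (17.1 * q) ^ 3) := by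
    apply mul_le_mul_of_nonneg_left _ (by positivity)
    calc pU ≤ 41 / 100 * b * T ^ 3 := hpU
      _ ≤ 41 / 100 * (L / 2) * (17.1 * q) ^ 3 := by
        apply mul_le_mul (by linarith) h1 (by positivity) (by positivity)
  have h3 : (6 * r) ^ 2 * (41 / 100 * (L / 2) * (17.1 * q) ^ 3) ≤ 37 * L := by
    have : (6 * r) ^ 2 * (41 / 100 * (L / 2) * (17.1 * q) ^ 3) =
        36 * (41 / 200) * 17.1 ^ 3 * (r * (r * (q : ℝ) ^ 3)) * L := by ring
    rw [this]
    have h4 : r * (r * (q : ℝ) ^ 3) ≤ 1 / 1000 * 1 := mul_le_mul hr1 hrq (by positivity) (by norm_num)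
    nlinarith
  have hL3 : 40000 * L ≤ L ^ 3 := by
    have hL2 : 200 * L ≤ L ^ 2 := by nlinarith
    nlinarith [hL2]
  nlinarith

/-- The rate bound `δU ≤ (7/100)·L√L/(q√q)`. [this track, ATTEMPT-19 §8 (P2)] -/
theorem deltaU_rate {q : ℕ} {L T pL : ℝ} (hq0 : (0 : ℝ) < q) (hL0 : 0 < L) (hTq2 : 16.83 * q ≤ T)
    (hpL : T ^ 3 / 31.42 ≤ pL) :
    3 / 5 * (L * Real.sqrt L) / Real.sqrt pL ≤ 7 / 100 * (L * Real.sqrt L) / ((q : ℝ) * Real.sqrt q) := by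
  have hpLq : (60 / 7) ^ 2 * (q : ℝ) ^ 3 ≤ pL := by
    have h1 : (16.83 * q) ^ 3 ≤ T ^ 3 := pow_le_pow_left₀ (by positivity) hTq2 3
    have h4 : T ^ 3 ≤ 31.42 * pL := by rw [div_le_iff₀ (by norm_num)] at hpL; linarith
    nlinarith [pow_pos hq0 3]
  have hpL0 : 0 < pL := lt_of_lt_of_le (by positivity) hpLq
  rw [div_le_div_iff₀ (Real.sqrt_pos.2 hpL0) (by positivity)]
  have hs : 60 / 7 * ((q : ℝ) * Real.sqrt q) ≤ Real.sqrt pL := by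
    rw [Real.le_sqrt (by positivity) hpL0.le, mul_pow, mul_pow, Real.sq_sqrt hq0.le]
    nlinarith
  have hLL : 0 ≤ L * Real.sqrt L := by positivity
  nlinarith [mul_le_mul_of_nonneg_left hs hLL]

/-- The window bound `(7/100)·L√L/(q√q) ≤ 1/(2(q+1))` for `q = e^L`, `L ≥ 200`. [this track, ATTEMPT-19 §8 (P2)] -/
theorem rate_le_half_inv {q : ℕ} {L : ℝ} (hqL : (q : ℝ) = Real.exp L) (hq0 : (0 : ℝ) < q) (hL200 : 200 ≤ L) :
    7 / 100 * (L * Real.sqrt L) / ((q : ℝ) * Real.sqrt q) ≤ 1 / (2 * ((q : ℝ) + 1)) := by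
  have hL0 : 0 < L := by linarith
  rw [div_le_div_iff₀ (by positivity) (by positivity)]
  have hsq : 0.1414 * (L * Real.sqrt L) ≤ Real.sqrt q := by
    rw [Real.le_sqrt (by positivity) hq0.le, mul_pow, mul_pow, Real.sq_sqrt hL0.le]
    have h4 : L ^ 4 / 24 ≤ Real.exp L := by
      have := Real.pow_div_factorial_le_exp L hL0.le 4
      norm_num [Nat.factorial] at this; exact this
    rw [← hqL] at h4
    nlinarith [pow_pos hL0 3]
  have hq200 : (201 : ℝ) ≤ q := by
    rw [hqL]; have := Real.add_one_le_exp L; linarith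
  have hLL : 0 ≤ L * Real.sqrt L := by positivity
  nlinarith [mul_le_mul_of_nonneg_left hsq hq0.le, Real.sqrt_nonneg (q : ℝ), mul_nonneg hLL (Real.sqrt_nonneg (q : ℝ))]

/-- **The window conditions (ATTEMPT-19 §8 (P2)).** [this track, ATTEMPT-19 §8 (P2)] -/
theorem window_conditions {q : ℕ} {L b r T pL pU y δU δL : ℝ} (hq : 2 ≤ q) (hL : L = Real.log q)
    (hr : r = 1 / ((q : ℝ) ^ 3 + 1)) (hbq1 : b + r ≤ L / 2) (hbq2 : L / 2 ≤ b + 2 * r) (hb : 100 ≤ b)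
    (hTe : Real.exp (2 * b) ≤ T) (hTT₀ : T ≤ 2 * π * Real.exp (1 + 2 * b))
    (hT₀T : 2 * π * Real.exp (1 + 2 * b) ≤ 101 / 100 * T) (hpL : T ^ 3 / (10 * π) ≤ pL) (hpU0 : 0 < pU)
    (hpU : pU ≤ 41 / 100 * b * T ^ 3) (hy : y = 3 / 5 * (L * Real.sqrt L)) (hδU : δU = y / Real.sqrt pL)
    (hδL : δL = y / Real.sqrt pU) :
    (2 * b ≤ L ∧ L ≤ 2 * b + 1) ∧ (0 ≤ δU ∧ δU ≤ 1 ∧ δU ≤ b) ∧ 6 * r ≤ δL ∧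
      δU ≤ 7 / 100 * Real.log q ^ (3 / 2 : ℝ) * (q : ℝ) ^ (-(3 / 2 : ℝ)) ∧
      (∀ q' : ℕ, q + 1 ≤ q' → Real.log q / 2 + δU ≤ Real.log q' / 2) ∧
      (0 < Real.sqrt q ∧ Real.sqrt q ≤ 1.011 * Real.exp b) := by
  have hπ4 : π < 3.1416 := Real.pi_lt_d4
  have hq0 : (0 : ℝ) < q := by exact_mod_cast (by omega : 0 < q)
  obtain ⟨hr0, hr1, hrq, hL200, hqL, hq200⟩ := radius_facts hq hL hr hbq1 hb
  obtain ⟨hE1, hE2, hTq1, hTq2⟩ := horizon_vs_q hqL hq0 hr0 hr1 hbq1 hbq2 hTT₀ hT₀T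
  have hL0 : 0 < L := by linarith
  have hL1 : 2 * b ≤ L := by linarith
  have hL2 : L ≤ 2 * b + 1 := by linarith
  have hT := horizon_master hb hTe
  have hT0 : 0 < T := by nlinarith
  have hpL' : T ^ 3 / 31.42 ≤ pL :=
    le_trans (div_le_div_of_nonneg_left (by positivity) (by positivity) (by linarith)) hpL
  have hpL0 : 0 < pL := lt_of_lt_of_le (by positivity) hpL'
  have hy0 : 0 ≤ y := by rw [hy]; positivity
  have hy2 : y ^ 2 = 9 / 25 * L ^ 3 := by rw [hy, mul_pow, mul_pow, Real.sq_sqrt hL0.le]; ring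
  have hδU0 : 0 ≤ δU := by rw [hδU]; positivity
  have hδU1 : δU ≤ 1 := by rw [hδU]; exact deltaU_le_one hb hL0 hL2 hT hpL' hy0 hy2
  have hδL6 : 6 * r ≤ δL := by
    rw [hδL]; exact radius_le_deltaL hr0 hr1 hrq hq0 hL200 hL1 hT0 hTq1 hpU0 hpU hy0 hy2
  have hrate : δU ≤ 7 / 100 * (L * Real.sqrt L) / ((q : ℝ) * Real.sqrt q) := by
    rw [hδU, hy]; exact deltaU_rate hq0 hL0 hTq2 hpL'
  have rpow32 : ∀ x : ℝ, 0 ≤ x → x ^ (3 / 2 : ℝ) = x * Real.sqrt x := fun x hx => by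
    rw [show (3 / 2 : ℝ) = 1 + 1 / 2 by norm_num, Real.rpow_add' hx (by norm_num), Real.rpow_one, Real.sqrt_eq_rpow]
  have hrate' : δU ≤ 7 / 100 * Real.log q ^ (3 / 2 : ℝ) * (q : ℝ) ^ (-(3 / 2 : ℝ)) := by
    rw [← hL, Real.rpow_neg hq0.le, rpow32 _ hL0.le, rpow32 _ hq0.le, ← div_eq_mul_inv]
    exact hrate
  have hwin : ∀ q' : ℕ, q + 1 ≤ q' → Real.log q / 2 + δU ≤ Real.log q' / 2 := by
    intro q' hq'
    have hq'0 : (q : ℝ) + 1 ≤ q' := by exact_mod_cast hq'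
    have h1 : Real.log ((q : ℝ) + 1) ≤ Real.log q' := Real.log_le_log (by positivity) hq'0
    have h2 : 1 / ((q : ℝ) + 1) ≤ Real.log ((q : ℝ) + 1) - Real.log q := by
      have := Real.one_sub_inv_le_log_of_pos (show 0 < ((q : ℝ) + 1) / q by positivity)
      rw [Real.log_div (by positivity) hq0.ne', inv_div] at this
      have e : 1 - (q : ℝ) / (q + 1) = 1 / (q + 1) := by field_simp; ring
      linarith
    have h3 : δU ≤ 1 / (2 * ((q : ℝ) + 1)) := hrate.trans (rate_le_half_inv hqL hq0 hL200)
    have h4 : 1 / (2 * ((q : ℝ) + 1)) * 2 = 1 / ((q : ℝ) + 1) := by field_simp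
    rw [← hL] at h2 ⊢
    linarith
  have hsq : Real.sqrt q = Real.exp (L / 2) := by
    rw [hqL, show Real.exp L = Real.exp (L / 2) ^ 2 by rw [← Real.exp_nat_mul]; ring_nf,
      Real.sqrt_sq (Real.exp_pos _).le]
  have hsq1 : Real.sqrt q ≤ 1.011 * Real.exp b := by
    rw [hsq]
    have h1 : Real.exp (L / 2) ≤ Real.exp (b + 2 * r) := Real.exp_le_exp.2 hbq2
    rw [Real.exp_add] at h1
    have h2 : Real.exp (2 * r) ≤ 1 + 2 * (2 * r) := by
      have h2r : 0 ≤ 2 * r := by linarith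
      have := Real.abs_exp_sub_one_le (x := 2 * r) (by rw [abs_of_nonneg h2r]; linarith)
      rw [abs_of_nonneg h2r] at this
      have := (abs_le.1 this).2
      linarith
    have h3 : Real.exp b * Real.exp (2 * r) ≤ Real.exp b * 1.011 :=
      mul_le_mul_of_nonneg_left (by linarith) (Real.exp_pos b).le
    linarith
  exact ⟨⟨hL1, hL2⟩, ⟨hδU0, hδU1, by linarith⟩, hδL6, hrate', hwin, ⟨Real.sqrt_pos.2 hq0, hsq1⟩⟩

end Summit.RiemannHypothesis.RiemannHypothesis.Theorems.Handoff
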